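import Literature.Barriers.NavierStokesRegularity.BuckmasterVicolNonuniquenessIterationProofs
import HarnessLib

/-!
# Buckmaster–Vicol nonuniqueness (ns.S18): the discharge

Sibling proof file of `Literature/Analysis/FluidPDE/BuckmasterVicol`: the named fact
`Literature.Analysis.FluidPDE.buckmasterVicol_nonuniqueness` (Buckmaster–Vicol, Ann. of Math. 189
(2019), Thm. 1.2, in the tree's `ν`-general rendering with one `β` for all `ν > 0`) is PROVED here,
`buckmasterVicol_nonuniqueness_holds`, by assembling three proved pieces of
`Literature/Barriers/NavierStokesRegularity/`:

* Prop. 2.1 of the paper (the convex-integration iteration with prescribed energy profile):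
  `Literature.Barriers.NavierStokesRegularity.BuckmasterVicol2019_prop21_holds`
  (`BuckmasterVicolNonuniquenessIterationProofs`);
* §2.4 (Prop. 2.1 ⇒ Thm. 1.2 as printed, `ν ∈ (0,1]`):
  `Literature.Barriers.NavierStokesRegularity.BuckmasterVicol2019_thm12_of_prop21`
  (`BuckmasterVicolNonuniquenessIteration`);
* the time-rescaling step (Thm. 1.2 at `ν = 1` ⇒ the `ν`-general in-tree statement):
  `Literature.Barriers.NavierStokesRegularity.buckmasterVicol_nonuniqueness_of_thm12`
  (`BuckmasterVicolNonuniquenessProofs`),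

packaged there as `BuckmasterVicolNonuniqueness_of_prop21`. This file lives under `Analysis/FluidPDE`
(and imports the barrier files, not conversely) because the fact it discharges is declared in the
namespace `Literature.Analysis.FluidPDE`; nothing in `Analysis/FluidPDE` imports it.

## References

* T. Buckmaster, V. Vicol, *Nonuniqueness of weak solutions to the Navier–Stokes equation*,
  Ann. of Math. 189 (2019), 101–144 = arXiv:1709.10033, Thm. 1.2, Prop. 2.1, §2.4. [`BuckmasterVicol2019AnnMath`]
-/

noncomputable section

namespace Literature.Analysis.FluidPDE

open Literature.Barriers.NavierStokesRegularity in
/-- **Buckmaster–Vicol 2019, Thm. 1.2 (ns.S18), proved**: there is `β > 0` such that for every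
`ν > 0`, every `T > 0` and every smooth nonnegative energy profile `e` on `[0,T]` there is a
mean-zero weak solution `v ∈ C⁰([0,T]; H^β(𝕋³))` of the unforced Navier–Stokes equations on
`𝕋³ × (0,T)` with `∫_{𝕋³} |v(t,x)|² dx = e(t)` for all `t ∈ [0,T]` — the named fact
`buckmasterVicol_nonuniqueness` holds. Proof: the catalogued barrier
`BuckmasterVicolNonuniqueness` is by definition this fact (`buckmasterVicolNonuniqueness_iff`) and
follows from Prop. 2.1 (`BuckmasterVicol2019_prop21_holds`) by
`BuckmasterVicolNonuniqueness_of_prop21` (§2.4 of the paper and time rescaling from `ν = 1`).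
[cite: BuckmasterVicol2019AnnMath, Thm. 1.2, Prop. 2.1 and §2.4] -/
theorem buckmasterVicol_nonuniqueness_holds : buckmasterVicol_nonuniqueness :=
  buckmasterVicolNonuniqueness_iff.mp (BuckmasterVicolNonuniqueness_of_prop21 BuckmasterVicol2019_prop21_holds)

end Literature.Analysis.FluidPDE

end
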